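import Summits.QuantumFields.QCD.Theorems.QuarksAsStableActionUnquenchedChessboardBoundStubAssemblyAux3
import Mathlib
import HarnessLib

/-!
# Assembly of the unquenched chessboard bound, part 4: the concrete letters
(stub `stub_assembly` of crux stmt-QuantumFields-9735, line Sketch; auxiliary file 4)

The concrete alphabet of the chessboard estimate: cell-plaquette labels `q = (b, ij)` (corner bits
`b : Fin 4 → Fin 2`, plane `ij`), placed at `pos c q = (c + b̂, ij)` where `b̂` forgets the
in-plane bits; the four commuting bit-flip involutions; translation / reflection / exchange
covariance and half-space locality of the placement; the marking word of a set of plaquettes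
(each plaquette assigned to the cell at its base point) and the count of marked cells.
All statements here are proved; no definitions are introduced.
-/

noncomputable section

open MeasureTheory Matrix Complex Finset
open Literature.MathematicalPhysics.QuantumFieldTheory Literature.MathematicalPhysics.QuantumLattice
open scoped ComplexConjugate BigOperators ComplexOrder

namespace Summit.QuantumFields.QCD.Theorems.UnquenchedChessboardBoundLine

/-! ## The concrete alphabet: corner bits and planes -/

section Letters

variable {L N : ℕ} [NeZero L]
variable {G : Type*} [Group G] [TopologicalSpace G] [IsTopologicalGroup G] [CompactSpace G]
  [MeasurableSpace G] [BorelSpace G]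
variable (ρ : G →* Matrix (Fin N) (Fin N) ℂ)

omit [NeZero L] in
/-- In `Fin 2`, adding one twice is the identity. -/
theorem asm_fin2_add_one_add_one (x : Fin 2) : x + 1 + 1 = x := by
  fin_cases x <;> rfl

/-- **The bit flips are involutions.** -/
theorem asm_bitFlip_involutive (k : Fin 4) :
    Function.Involutive fun q : (Fin 4 → Fin 2) × {p : Fin 4 × Fin 4 // p.1 < p.2} =>
      (Function.update q.1 k (q.1 k + 1), q.2) := by
  intro q
  refine Prod.ext ?_ rfl
  funext l
  by_cases hl : l = k
  · subst hl; simp [asm_fin2_add_one_add_one]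
  · simp [hl]

/-- **The bit flips commute.** -/
theorem asm_bitFlip_comm (k k' : Fin 4) (q : (Fin 4 → Fin 2) × {p : Fin 4 × Fin 4 // p.1 < p.2}) :
    ((Function.update (Function.update q.1 k' (q.1 k' + 1)) k
        (Function.update q.1 k' (q.1 k' + 1) k + 1), q.2) :
        (Fin 4 → Fin 2) × {p : Fin 4 × Fin 4 // p.1 < p.2}) =
      (Function.update (Function.update q.1 k (q.1 k + 1)) k'
        (Function.update q.1 k (q.1 k + 1) k' + 1), q.2) := by
  refine Prod.ext ?_ rfl
  funext l
  by_cases hkk : k = k'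
  · subst hkk; rfl
  · by_cases hl : l = k
    · subst hl; simp [hkk]
    · by_cases hl' : l = k'
      · subst hl'; simp [hl]
      · simp [hl, hl']

omit [NeZero L] in
/-- **Translation covariance of the placement.** -/
theorem asm_pos_add (c v : Fin 4 → ZMod L) (q : (Fin 4 → Fin 2) × {p : Fin 4 × Fin 4 // p.1 < p.2}) :
    ((c + v + fun k => if k = q.2.1.1 ∨ k = q.2.1.2 then 0 else ((q.1 k).val : ZMod L), q.2) :
        Plaquette 4 L) =
      ((c + fun k => if k = q.2.1.1 ∨ k = q.2.1.2 then 0 else ((q.1 k).val : ZMod L)) + v, q.2) := by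
  refine Prod.ext ?_ rfl
  exact add_right_comm _ _ _

omit [NeZero L] in
/-- The corners of a placed plaquette lie in the closed unit cube of the cell. -/
theorem asm_pos_apply_mem (c : Fin 4 → ZMod L) (q : (Fin 4 → Fin 2) × {p : Fin 4 × Fin 4 // p.1 < p.2})
    (k : Fin 4) :
    (c + fun k => if k = q.2.1.1 ∨ k = q.2.1.2 then 0 else ((q.1 k).val : ZMod L)) k = c k ∨
      (c + fun k => if k = q.2.1.1 ∨ k = q.2.1.2 then 0 else ((q.1 k).val : ZMod L)) k = c k + 1 := by
  simp only [Pi.add_apply]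
  split_ifs
  · left; rw [add_zero]
  · have h : (q.1 k).val = 0 ∨ (q.1 k).val = 1 := by
      have := (q.1 k).isLt; omega
    rcases h with h | h
    · left; rw [h, Nat.cast_zero, add_zero]
    · right; rw [h, Nat.cast_one]

omit [NeZero L] in
/-- **Reflection covariance of the placement**: the time reflection of a placed plaquette is the
plaquette placed, with the time bit flipped, in the reflected cell. -/
theorem asm_sitePlaqReflect_pos (c : Fin 4 → ZMod L) (q : (Fin 4 → Fin 2) × {p : Fin 4 × Fin 4 // p.1 < p.2}) :
    WilsonSiteRP.sitePlaqReflect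
        ((c + fun k => if k = q.2.1.1 ∨ k = q.2.1.2 then 0 else ((q.1 k).val : ZMod L), q.2) :
          Plaquette 4 L) =
      ((Function.update c 0 (-1 - c 0) + fun k => if k = q.2.1.1 ∨ k = q.2.1.2 then 0
        else ((Function.update q.1 0 (q.1 0 + 1) k).val : ZMod L)), q.2) := by
  unfold WilsonSiteRP.sitePlaqReflect
  refine Prod.ext ?_ rfl
  funext k
  simp only
  by_cases ha : q.2.1.1 = 0
  · rw [if_pos ha]
    by_cases hk : k = 0
    · subst hk
      rw [WilsonSiteRP.negReflect_apply_zero, WilsonRP.shift_apply_self]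
      simp [ha]
      ring
    · rw [WilsonSiteRP.negReflect_apply_of_ne _ hk, WilsonRP.shift_apply_of_ne _ hk]
      simp [hk]
  · rw [if_neg ha]
    have hb : q.2.1.2 ≠ 0 := fun h => by
      have := q.2.2; rw [h] at this; exact absurd this (Fin.not_lt_zero _)
    by_cases hk : k = 0
    · subst hk
      rw [WilsonSiteRP.negReflect_apply_zero]
      simp only [Pi.add_apply, Function.update_self, Ne.symm ha, Ne.symm hb, or_self, if_false]
      have h : q.1 0 = 0 ∨ q.1 0 = 1 := by
        rcases Fin.exists_fin_two.mp ⟨q.1 0, rfl⟩ with h | h <;> simp [h]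
      rcases h with h | h <;> simp [h] <;> ring
    · rw [WilsonSiteRP.negReflect_apply_of_ne _ hk]
      simp [hk]

/-- **Half-space locality of the placement**: plaquettes placed in cells of the half `{t < L/2}`
are positive or shared for the site reflection. -/
theorem asm_pos_half [Fact (1 < L)] (hL : Even L) (c : Fin 4 → ZMod L)
    (q : (Fin 4 → Fin 2) × {p : Fin 4 × Fin 4 // p.1 < p.2}) (hc : (c 0).val < L / 2) :
    WilsonSiteRP.IsSitePosPlaq
        ((c + fun k => if k = q.2.1.1 ∨ k = q.2.1.2 then 0 else ((q.1 k).val : ZMod L), q.2) :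
          Plaquette 4 L) ∨
      WilsonSiteRP.IsSharedPlaq
        ((c + fun k => if k = q.2.1.1 ∨ k = q.2.1.2 then 0 else ((q.1 k).val : ZMod L), q.2) :
          Plaquette 4 L) := by
  have h1L : 1 < L := Fact.out
  have hE := Nat.even_iff.mp hL
  unfold WilsonSiteRP.IsSitePosPlaq WilsonSiteRP.IsSharedPlaq
  simp only [Pi.add_apply]
  by_cases ha : q.2.1.1 = 0
  · left
    rw [if_pos ha, if_pos (Or.inl ha.symm), add_zero]
    exact hc
  · rw [if_neg ha]
    have hb : q.2.1.2 ≠ 0 := fun h => by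
      have := q.2.2; rw [h] at this; exact absurd this (Fin.not_lt_zero _)
    rw [if_neg (by rintro (h | h) <;> simp_all)]
    have hn : (q.1 0).val ≤ 1 := by have := (q.1 0).isLt; omega
    have hv : (c 0 + ((q.1 0).val : ZMod L)).val = (c 0).val + (q.1 0).val := by
      rw [ZMod.val_add, ZMod.val_natCast, Nat.mod_eq_of_lt (show (q.1 0).val < L by omega),
        Nat.mod_eq_of_lt (by omega)]
    rw [hv]
    simp only [ne_eq, ha, not_false_eq_true, true_and]
    omega

omit [NeZero L] in
/-- **Cube property of the placement**: every coordinate of a placed plaquette is the cell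
coordinate or its successor. -/
theorem asm_pos_fst_apply (x : Fin 4 → ZMod L) (q : (Fin 4 → Fin 2) × {p : Fin 4 × Fin 4 // p.1 < p.2})
    (k : Fin 4) :
    ((x + fun k => if k = q.2.1.1 ∨ k = q.2.1.2 then 0 else ((q.1 k).val : ZMod L), q.2) :
        Plaquette 4 L).1 k = x k ∨
      ((x + fun k => if k = q.2.1.1 ∨ k = q.2.1.2 then 0 else ((q.1 k).val : ZMod L), q.2) :
        Plaquette 4 L).1 k = x k + 1 :=
  asm_pos_apply_mem x q k

omit [NeZero L] in
/-- Composition with the coordinate exchange distributes over the placement offset. -/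
theorem asm_pos_fst_comp_swap (i : Fin 4) (c : Fin 4 → ZMod L)
    (q : (Fin 4 → Fin 2) × {p : Fin 4 × Fin 4 // p.1 < p.2}) (a b : Fin 4)
    (hab : (a = Equiv.swap (0 : Fin 4) i q.2.1.1 ∧ b = Equiv.swap (0 : Fin 4) i q.2.1.2) ∨
      (a = Equiv.swap (0 : Fin 4) i q.2.1.2 ∧ b = Equiv.swap (0 : Fin 4) i q.2.1.1)) :
    ((c + fun k => if k = q.2.1.1 ∨ k = q.2.1.2 then 0 else ((q.1 k).val : ZMod L)) ∘
        Equiv.swap (0 : Fin 4) i : Fin 4 → ZMod L) =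
      (c ∘ Equiv.swap (0 : Fin 4) i) + fun k => if k = a ∨ k = b then 0
        else (((q.1 ∘ Equiv.swap (0 : Fin 4) i) k).val : ZMod L) := by
  funext k
  simp only [Function.comp_apply, Pi.add_apply]
  congr 1
  have hk : (Equiv.swap (0 : Fin 4) i k = q.2.1.1 ∨ Equiv.swap (0 : Fin 4) i k = q.2.1.2) ↔
      (k = a ∨ k = b) := by
    rw [Equiv.swap_apply_eq_iff, Equiv.swap_apply_eq_iff (w := q.2.1.2)]
    rcases hab with ⟨rfl, rfl⟩ | ⟨rfl, rfl⟩
    · exact Iff.rfl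
    · exact or_comm
  simp only [hk]

omit [NeZero L] [MeasurableSpace G] [BorelSpace G] in
/-- **Exchange covariance of the placement.** There is a relabelling `sw` of the cell-plaquette
labels (exchange the corner bits, exchange and reorder the plane) such that the deficit of a placed
plaquette for the exchanged field is the deficit of the relabelled plaquette placed in the exchanged
cell, and `sw` intertwines the bit flip in direction `i` with the bit flip in direction `0`. -/
theorem asm_exists_swapLabel (hρ : Continuous ρ) (i : Fin 4) :
    ∃ sw : (Fin 4 → Fin 2) × {p : Fin 4 × Fin 4 // p.1 < p.2} →
        (Fin 4 → Fin 2) × {p : Fin 4 × Fin 4 // p.1 < p.2},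
      (∀ (U : GaugeConfig 4 L G) (c : Fin 4 → ZMod L)
        (q : (Fin 4 → Fin 2) × {p : Fin 4 × Fin 4 // p.1 < p.2}),
        plaquetteDeficit ρ (fun e => U (e.1 ∘ Equiv.swap (0 : Fin 4) i, Equiv.swap (0 : Fin 4) i e.2))
          ((c + fun k => if k = q.2.1.1 ∨ k = q.2.1.2 then 0 else ((q.1 k).val : ZMod L), q.2) :
            Plaquette 4 L) =
        plaquetteDeficit ρ U
          (((c ∘ Equiv.swap (0 : Fin 4) i) + fun k => if k = (sw q).2.1.1 ∨ k = (sw q).2.1.2 then 0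
            else (((sw q).1 k).val : ZMod L), (sw q).2) : Plaquette 4 L)) ∧
      ∀ q : (Fin 4 → Fin 2) × {p : Fin 4 × Fin 4 // p.1 < p.2},
        sw (Function.update q.1 i (q.1 i + 1), q.2) =
          (Function.update (sw q).1 0 ((sw q).1 0 + 1), (sw q).2) := by
  -- the reordered exchanged plane
  have hne : ∀ q : (Fin 4 → Fin 2) × {p : Fin 4 × Fin 4 // p.1 < p.2},
      ¬ Equiv.swap (0 : Fin 4) i q.2.1.1 < Equiv.swap (0 : Fin 4) i q.2.1.2 →
        Equiv.swap (0 : Fin 4) i q.2.1.2 < Equiv.swap (0 : Fin 4) i q.2.1.1 := fun q h =>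
    lt_of_le_of_ne (not_lt.mp h) fun h' => (ne_of_lt q.2.2) ((Equiv.swap (0 : Fin 4) i).injective h').symm
  refine ⟨fun q => (q.1 ∘ Equiv.swap (0 : Fin 4) i,
    if h : Equiv.swap (0 : Fin 4) i q.2.1.1 < Equiv.swap (0 : Fin 4) i q.2.1.2
    then ⟨(Equiv.swap (0 : Fin 4) i q.2.1.1, Equiv.swap (0 : Fin 4) i q.2.1.2), h⟩
    else ⟨(Equiv.swap (0 : Fin 4) i q.2.1.2, Equiv.swap (0 : Fin 4) i q.2.1.1), hne q h⟩),
    fun U c q => ?_, fun q => ?_⟩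
  · simp only [plaquetteDeficit, asm_plaquetteHolonomy_axisSwap]
    by_cases h : Equiv.swap (0 : Fin 4) i q.2.1.1 < Equiv.swap (0 : Fin 4) i q.2.1.2
    · simp only [h, dif_pos]
      rw [asm_pos_fst_comp_swap i c q _ _ (Or.inl ⟨rfl, rfl⟩)]
    · simp only [h, dif_neg, not_false_eq_true]
      rw [asm_pos_fst_comp_swap i c q _ _ (Or.inr ⟨rfl, rfl⟩), asm_re_trace_plaquetteHolonomy_symm ρ hρ]
  · refine Prod.ext ?_ rfl
    simp only
    have h1 := Function.update_comp_eq_of_injective q.1 (Equiv.swap (0 : Fin 4) i).injective 0 (q.1 i + 1)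
    rw [Equiv.swap_apply_left] at h1
    rw [h1]
    simp

/-! ## The marking word of a set of plaquettes -/

omit [NeZero L] in
/-- The plaquette with zero corner bits is placed at the base point of the cell. -/
theorem asm_pos_zero_bits (c : Fin 4 → ZMod L) (ij : {p : Fin 4 × Fin 4 // p.1 < p.2}) :
    ((c + fun k => if k = ij.1.1 ∨ k = ij.1.2 then 0 else (((0 : Fin 4 → Fin 2) k).val : ZMod L), ij) :
        Plaquette 4 L) = (c, ij) := by
  refine Prod.ext ?_ rfl
  funext k
  simp

omit [NeZero L] [MeasurableSpace G] [BorelSpace G] [TopologicalSpace G] [IsTopologicalGroup G]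
  [CompactSpace G] in
/-- **The event of the marking word** of `R` (letter at cell `c` = the plaquettes of `R` based at `c`,
with zero corner bits) is the event that every plaquette of `R` is `δ`-bad. -/
theorem asm_markEvent_eq (δ : ℝ) (R : Finset (Plaquette 4 L)) :
    {U : GaugeConfig 4 L G | ∀ c, ∀ q ∈ (Finset.univ.filter fun q : (Fin 4 → Fin 2) ×
        {p : Fin 4 × Fin 4 // p.1 < p.2} => q.1 = 0 ∧ (c, q.2) ∈ R),
        δ ≤ plaquetteDeficit ρ U
          ((c + fun k => if k = q.2.1.1 ∨ k = q.2.1.2 then 0 else ((q.1 k).val : ZMod L), q.2) :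
            Plaquette 4 L)} =
      {U : GaugeConfig 4 L G | ∀ p ∈ R, δ ≤ plaquetteDeficit ρ U p} := by
  ext U
  simp only [Set.mem_setOf_eq, Finset.mem_filter, Finset.mem_univ, true_and]
  constructor
  · intro h p hp
    have h' := h p.1 ((0 : Fin 4 → Fin 2), p.2) ⟨rfl, hp⟩
    rwa [asm_pos_zero_bits] at h'
  · rintro h c ⟨b, ij⟩ ⟨hb, hq⟩
    simp only at hb hq
    subst hb
    rw [asm_pos_zero_bits]
    exact h _ hq

omit [NeZero L] in
/-- There are six coordinate planes in four dimensions. -/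
theorem asm_card_planes : Fintype.card {p : Fin 4 × Fin 4 // p.1 < p.2} = 6 := by
  decide

end Letters

section MainCount

/-- **Counting marked cells**: each plaquette of `R` marks the cell at its base point, and a cell
carries at most six plaquettes, so `|R| ≤ 6 · #{marked cells}`. -/
theorem asm_card_le_six_mul_card_marked {L : ℕ} [NeZero L] (R : Finset (Plaquette 4 L)) :
    R.card ≤ 6 * (Finset.univ.filter fun c : Fin 4 → ZMod L =>
      ¬ ((Finset.univ.filter fun q : (Fin 4 → Fin 2) × {p : Fin 4 × Fin 4 // p.1 < p.2} =>
        q.1 = 0 ∧ (c, q.2) ∈ R) = ∅)).card := by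
  classical
  have h1 : R.card ≤ 6 * (R.image Prod.fst).card := by
    refine Finset.card_le_mul_card_image R 6 fun c _ => ?_
    calc (R.filter fun p => p.1 = c).card
        ≤ ((Finset.univ : Finset {p : Fin 4 × Fin 4 // p.1 < p.2}).image fun ij => (c, ij)).card := by
          refine Finset.card_le_card fun p hp => ?_
          rw [Finset.mem_filter] at hp
          rw [Finset.mem_image]
          exact ⟨p.2, Finset.mem_univ _, by rw [← hp.2]⟩
      _ ≤ (Finset.univ : Finset {p : Fin 4 × Fin 4 // p.1 < p.2}).card := Finset.card_image_le
      _ = 6 := by rw [Finset.card_univ, asm_card_planes]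
  refine h1.trans (Nat.mul_le_mul_left 6 (Finset.card_le_card fun c hc => ?_))
  rw [Finset.mem_image] at hc
  obtain ⟨p, hp, rfl⟩ := hc
  rw [Finset.mem_filter]
  refine ⟨Finset.mem_univ _, fun h0 => ?_⟩
  have hmem : (((0 : Fin 4 → Fin 2), p.2) : (Fin 4 → Fin 2) × {p : Fin 4 × Fin 4 // p.1 < p.2}) ∈
      (Finset.univ.filter fun q : (Fin 4 → Fin 2) × {p : Fin 4 × Fin 4 // p.1 < p.2} =>
        q.1 = 0 ∧ (p.1, q.2) ∈ R) := by
    simp [hp]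
  rw [h0] at hmem
  exact Finset.notMem_empty _ hmem

end MainCount

end Summit.QuantumFields.QCD.Theorems.UnquenchedChessboardBoundLine

end
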